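import Summits.CriticalPhenomena.PercolationContinuityZ3.Theorems.PercNearOneGluingNoHeavyLowerTailHybridRowsLeFive
import Summits.CriticalPhenomena.PercolationContinuityZ3.Theorems.PercNearOneGluingNoHeavyLowerTailE3GroupSepLeFive

/-!
# `NoHeavyLowerTail` (crux stmt-CriticalPhenomena-4575), master family: ALL 45 ESSENTIAL decreasing cubic (`E₃`) rows on FOUR marked points hold on
# every weighted graph with at most five vertices, for ALL edge weights — kernel-checked three-copy comb certificates (bounded-n base of the 4-point cubic frontier)

Support file (prover seat `prim-bnk-1`, bounded-n kernel theorems; `--supports stmt-CriticalPhenomena-4575`; COMPUTATIONAL: ninety `checkC` evaluations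
use `native_decide`).

Context.  On four marked points `a, b, c, y` there are 25 group-separation events `D[X|Y] = {no open path between the terminal groups X and Y}` (decreasing)
and `2300` unordered triples of them; the Richards–Sahi functional `E₃(A,B,C) = 2μ(ABC) + μ(A)μ(B)μ(C) − μ(A)μ(BC) − μ(B)μ(AC) − μ(C)μ(AB)` (`sahiE3`) is
conjectured nonnegative on decreasing triples (Sahi's `C₃`; open in general).  The exact LP map of the sibling seat `prim-masterthm-p1`
(run/shared/lean/prim/prim-masterthm/prim-masterthm-p1/FRONTIER-4PT.md, 2026-08-20, jobs j083550/j084116) finds: `1575` of the `2300` triples are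
HARRIS-GENERATED (exact nonnegative combinations of `μ(D)·E₂(D′,D″)` over the 25 events and their pairwise intersections, plus monomials — hence true on every
finite weighted graph by Harris' inequality), and `725` triples in `45` orbits of `S₄` are NOT ("essential"); of the 45 essential orbits, 8 are exact
consequences of the proved cubic families (3PT-LB / group / hybrid / GR3) + Harris and 37 are not.  All 2300 are census-clean (ttrl `cp-e4`, `n ≤ 8/9`), and all
`314 626` canonical monotone 4-terminal pattern triples are three-copy comb positive on `K₄` and `K₅` (prim-bnk-1 kit atlas j077089; one C implementation).

**Theorems.**  For each essential orbit `i : Fin 45` (representative `row i`, table below, same order as FRONTIER-4PT.md):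
* `frontier_le_five i : ∀ n ≤ 5, ∀ w, ∀ a b c y` pairwise distinct, `0 ≤ cval w (e3Terms D₁ D₂ D₃)` (term form);
* `frontier_sahiE3_le_five i`: the same as `0 ≤ sahiE3 (prodBernoulli w) (connEvent D₁) (connEvent D₂) (connEvent D₃)`
  (`E3GroupSepCert.connEvent_sep` unfolds `connEvent (sep X Y)` to `{ω | ∀ x ∈ X, ∀ y ∈ Y, ω ∉ openConn x y}`);
* spelled out: `star_le_five` (`i = 42`: `0 ≤ E₃({a↮b}, {a↮c}, {a↮y})`) and `threeIsolated_le_five` (`i = 41`: `E₃(D[abc|y], D[aby|c], D[acy|b]) ≥ 0`).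
Since every pairwise distinct quadruple is covered, theorem `i` covers the whole `S₄`-orbit of its representative; with the Harris-generated triples (all `n`,
by p1's exact certificates — not replayed here) this accounts for every one of the 2300 decreasing 4-point group-separation triples on graphs with `≤ 5` vertices.
PROOF = `CombRows.quad_cval_le_five`: the term family is relabelling-equivariant (`rfl`) and the three-copy checker `checkC` of `…E3GroupSepCertCheck` passes at
the standard quadruple of `K₄` (base `2^23`) and `K₅` (base `2^35`) — all `4^6` resp. `4^10` tensor-Bernstein fibre sums are nonnegative (Richards-comb positive;
a second, in-kernel implementation of the atlas verdict for these 45 rows; whole file ≈ 75 s on the farm).  NOTHING is claimed beyond five vertices: the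
all-`n` statements of the 37 unimplied orbits are OPEN.

| `i` | representative `(D₁, D₂, D₃)` | orbit size | implied by proved cubic families + Harris (FRONTIER-4PT, closure v1)? |
|---|---|---|---|
| 0 | `D[abc|y], D[aby|c], D[ac|b]` | 24 | NO (24/24) |
| 1 | `D[abc|y], D[ab|c], D[ac|by]` | 24 | NO (24/24) |
| 2 | `D[abc|y], D[ab|c], D[ay|b]` | 24 | NO (24/24) |
| 3 | `D[abc|y], D[ab|cy], D[ay|b]` | 24 | NO (24/24) |
| 4 | `D[abc|y], D[ay|b], D[a|c]` | 24 | NO (24/24) |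
| 5 | `D[abc|y], D[ay|b], D[a|cy]` | 24 | NO (24/24) |
| 6 | `D[abc|y], D[ay|b], D[b|c]` | 24 | NO (24/24) |
| 7 | `D[ab|c], D[ab|y], D[ac|b]` | 24 | NO (24/24) |
| 8 | `D[ab|c], D[ab|y], D[ac|y]` | 24 | yes |
| 9 | `D[ab|c], D[ac|b], D[by|c]` | 24 | yes |
| 10 | `D[ab|c], D[ac|b], D[b|y]` | 24 | NO (24/24) |
| 11 | `D[ab|c], D[ac|by], D[ay|b]` | 24 | NO (24/24) |
| 12 | `D[ab|c], D[ac|by], D[b|y]` | 24 | NO (24/24) |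
| 13 | `D[ab|c], D[ac|y], D[a|b]` | 24 | NO (24/24) |
| 14 | `D[ab|c], D[ac|y], D[a|by]` | 24 | NO (24/24) |
| 15 | `D[ab|c], D[ac|y], D[b|y]` | 24 | NO (24/24) |
| 16 | `D[ab|c], D[ay|c], D[a|b]` | 24 | yes |
| 17 | `D[ab|c], D[a|b], D[a|cy]` | 24 | yes |
| 18 | `D[ab|c], D[a|b], D[a|y]` | 24 | NO (24/24) |
| 19 | `D[ab|c], D[a|y], D[c|y]` | 24 | yes |
| 20 | `D[abc|y], D[aby|c], D[ac|by]` | 12 | NO (12/12) |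
| 21 | `D[abc|y], D[ab|c], D[ac|b]` | 12 | NO (12/12) |
| 22 | `D[abc|y], D[ab|c], D[a|b]` | 12 | NO (12/12) |
| 23 | `D[abc|y], D[ab|cy], D[a|b]` | 12 | NO (12/12) |
| 24 | `D[abc|y], D[ay|b], D[ay|c]` | 12 | NO (12/12) |
| 25 | `D[abc|y], D[ay|b], D[b|cy]` | 12 | NO (12/12) |
| 26 | `D[abc|y], D[a|b], D[a|c]` | 12 | NO (12/12) |
| 27 | `D[ab|c], D[ab|y], D[ac|by]` | 12 | NO (12/12) |
| 28 | `D[ab|c], D[ac|b], D[a|y]` | 12 | NO (12/12) |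
| 29 | `D[ab|c], D[ac|b], D[bc|y]` | 12 | NO (12/12) |
| 30 | `D[ab|c], D[ac|by], D[b|cy]` | 12 | NO (12/12) |
| 31 | `D[ab|c], D[ac|y], D[bc|y]` | 12 | NO (12/12) |
| 32 | `D[ab|c], D[ay|c], D[b|y]` | 12 | yes |
| 33 | `D[ab|c], D[a|b], D[c|y]` | 12 | NO (12/12) |
| 34 | `D[ab|c], D[a|cy], D[b|y]` | 12 | NO (12/12) |
| 35 | `D[ab|c], D[a|y], D[b|y]` | 12 | NO (12/12) |
| 36 | `D[a|b], D[a|c], D[b|y]` | 12 | NO (12/12) |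
| 37 | `D[ab|c], D[ac|y], D[ay|b]` | 8 | NO (8/8) |
| 38 | `D[abc|y], D[aby|c], D[a|b]` | 6 | NO (6/6) |
| 39 | `D[ab|c], D[ab|y], D[a|b]` | 6 | NO (6/6) |
| 40 | `D[ab|c], D[ab|y], D[c|y]` | 6 | yes |
| 41 | `D[abc|y], D[aby|c], D[acy|b]` | 4 | NO (4/4) |
| 42 | `D[a|b], D[a|c], D[a|y]` | 4 | NO (4/4) |
| 43 | `D[a|b], D[a|c], D[b|c]` | 4 | yes |
| 44 | `D[ab|cy], D[a|b], D[c|y]` | 3 | NO (3/3) |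
-/

namespace Summit.CriticalPhenomena.PercolationContinuityZ3.Theorems.FrontierDecRows

open Finset MeasureTheory OneCutCert CovTransferCert E3GroupSepCert CombRows HybridRows
open scoped BigOperators
open Literature.Probability.Percolation Literature.Probability.LatticeModels

variable {n : ℕ}

/-- The 45 representative triples (order of FRONTIER-4PT.md), as `sep` predicates at the quadruple `(a,b,c,y)`. [this work] -/
def row (i : Fin 45) (n : ℕ) (x : Quad n) : (CRel n → Bool) × (CRel n → Bool) × (CRel n → Bool) :=
  let a := x.1
  let b := x.2.1
  let c := x.2.2.1
  let y := x.2.2.2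
  match i with
  | 0 => (sep [a, b, c] [y], sep [a, b, y] [c], sep [a, c] [b])
  | 1 => (sep [a, b, c] [y], sep [a, b] [c], sep [a, c] [b, y])
  | 2 => (sep [a, b, c] [y], sep [a, b] [c], sep [a, y] [b])
  | 3 => (sep [a, b, c] [y], sep [a, b] [c, y], sep [a, y] [b])
  | 4 => (sep [a, b, c] [y], sep [a, y] [b], sep [a] [c])
  | 5 => (sep [a, b, c] [y], sep [a, y] [b], sep [a] [c, y])
  | 6 => (sep [a, b, c] [y], sep [a, y] [b], sep [b] [c])
  | 7 => (sep [a, b] [c], sep [a, b] [y], sep [a, c] [b])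
  | 8 => (sep [a, b] [c], sep [a, b] [y], sep [a, c] [y])
  | 9 => (sep [a, b] [c], sep [a, c] [b], sep [b, y] [c])
  | 10 => (sep [a, b] [c], sep [a, c] [b], sep [b] [y])
  | 11 => (sep [a, b] [c], sep [a, c] [b, y], sep [a, y] [b])
  | 12 => (sep [a, b] [c], sep [a, c] [b, y], sep [b] [y])
  | 13 => (sep [a, b] [c], sep [a, c] [y], sep [a] [b])
  | 14 => (sep [a, b] [c], sep [a, c] [y], sep [a] [b, y])
  | 15 => (sep [a, b] [c], sep [a, c] [y], sep [b] [y])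
  | 16 => (sep [a, b] [c], sep [a, y] [c], sep [a] [b])
  | 17 => (sep [a, b] [c], sep [a] [b], sep [a] [c, y])
  | 18 => (sep [a, b] [c], sep [a] [b], sep [a] [y])
  | 19 => (sep [a, b] [c], sep [a] [y], sep [c] [y])
  | 20 => (sep [a, b, c] [y], sep [a, b, y] [c], sep [a, c] [b, y])
  | 21 => (sep [a, b, c] [y], sep [a, b] [c], sep [a, c] [b])
  | 22 => (sep [a, b, c] [y], sep [a, b] [c], sep [a] [b])
  | 23 => (sep [a, b, c] [y], sep [a, b] [c, y], sep [a] [b])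
  | 24 => (sep [a, b, c] [y], sep [a, y] [b], sep [a, y] [c])
  | 25 => (sep [a, b, c] [y], sep [a, y] [b], sep [b] [c, y])
  | 26 => (sep [a, b, c] [y], sep [a] [b], sep [a] [c])
  | 27 => (sep [a, b] [c], sep [a, b] [y], sep [a, c] [b, y])
  | 28 => (sep [a, b] [c], sep [a, c] [b], sep [a] [y])
  | 29 => (sep [a, b] [c], sep [a, c] [b], sep [b, c] [y])
  | 30 => (sep [a, b] [c], sep [a, c] [b, y], sep [b] [c, y])
  | 31 => (sep [a, b] [c], sep [a, c] [y], sep [b, c] [y])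
  | 32 => (sep [a, b] [c], sep [a, y] [c], sep [b] [y])
  | 33 => (sep [a, b] [c], sep [a] [b], sep [c] [y])
  | 34 => (sep [a, b] [c], sep [a] [c, y], sep [b] [y])
  | 35 => (sep [a, b] [c], sep [a] [y], sep [b] [y])
  | 36 => (sep [a] [b], sep [a] [c], sep [b] [y])
  | 37 => (sep [a, b] [c], sep [a, c] [y], sep [a, y] [b])
  | 38 => (sep [a, b, c] [y], sep [a, b, y] [c], sep [a] [b])
  | 39 => (sep [a, b] [c], sep [a, b] [y], sep [a] [b])
  | 40 => (sep [a, b] [c], sep [a, b] [y], sep [c] [y])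
  | 41 => (sep [a, b, c] [y], sep [a, b, y] [c], sep [a, c, y] [b])
  | 42 => (sep [a] [b], sep [a] [c], sep [a] [y])
  | 43 => (sep [a] [b], sep [a] [c], sep [b] [c])
  | 44 => (sep [a, b] [c, y], sep [a] [b], sep [c] [y])
  | _ => (pTrue, pTrue, pTrue)  -- unreachable (the `Fin 45` literal patterns above are exhaustive; the match compiler does not see it at this size)

/-- The `E₃` term family of row `i`. [this work] -/
def terms (i : Fin 45) (n : ℕ) (x : Quad n) : List (CTerm n) :=
  e3Terms (row i n x).1 (row i n x).2.1 (row i n x).2.2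

/-- Each family commutes with vertex relabellings. [this work] -/
theorem terms_equivariant (i : Fin 45) : QuadEquivariant (terms i) := by
  intro n τ x
  obtain ⟨a, b, c, y⟩ := x
  fin_cases i <;> rfl

/-- `K₄` checks (base `2^23`): all `4^6` fibre sums nonnegative. [this work] -/
theorem combCheck4 (i : Fin 45) : checkC 4 23 (terms i 4 (quad₀ 4 le_rfl)) = true := by
  fin_cases i <;> native_decide

/-- `K₅` checks (base `2^35`): all `4^10` fibre sums nonnegative. [this work] -/
theorem combCheck5 (i : Fin 45) : checkC 5 35 (terms i 5 (quad₀ 5 (by norm_num))) = true := by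
  fin_cases i <;> native_decide

/-- **The 45 essential rows (term form) on every weighted graph with at most five vertices, all weights, all pairwise distinct `a b c y`.** [this work] -/
theorem frontier_le_five (i : Fin 45) : ∀ n ≤ 5, ∀ (w : Sym2 (Fin n) → unitInterval) (a b c y : Fin n),
    a ≠ b → a ≠ c → a ≠ y → b ≠ c → b ≠ y → c ≠ y → 0 ≤ cval w (terms i n (a, b, c, y)) :=
  quad_cval_le_five (terms_equivariant i) (combCheck4 i) (combCheck5 i)

/-- **The 45 essential rows in `sahiE3` form**: `0 ≤ E₃(D₁, D₂, D₃)` under `prodBernoulli w` for the representative triple `row i` at any pairwise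
distinct `a b c y` of a graph with `n ≤ 5` vertices. [this work] -/
theorem frontier_sahiE3_le_five (i : Fin 45) (hn : n ≤ 5) (w : Sym2 (Fin n) → unitInterval) (a b c y : Fin n) (hab : a ≠ b)
    (hac : a ≠ c) (hay : a ≠ y) (hbc : b ≠ c) (hby : b ≠ y) (hcy : c ≠ y) :
    0 ≤ sahiE3 (prodBernoulli w) (connEvent (row i n (a, b, c, y)).1) (connEvent (row i n (a, b, c, y)).2.1)
      (connEvent (row i n (a, b, c, y)).2.2) := by
  have h := frontier_le_five i n hn w a b c y hab hac hay hbc hby hcy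
  unfold terms at h
  rwa [cval_e3Terms] at h

/-- **The STAR row on ≤ 5 vertices** (orbit 42; not implied by the proved cubic families): `0 ≤ E₃({a↮b}, {a↮c}, {a↮y})`. [this work] -/
theorem star_le_five (hn : n ≤ 5) (w : Sym2 (Fin n) → unitInterval) (a b c y : Fin n) (hab : a ≠ b) (hac : a ≠ c)
    (hay : a ≠ y) (hbc : b ≠ c) (hby : b ≠ y) (hcy : c ≠ y) :
    0 ≤ sahiE3 (prodBernoulli w) (openConn a b)ᶜ (openConn a c)ᶜ (openConn a y)ᶜ := by
  have h := frontier_sahiE3_le_five 42 hn w a b c y hab hac hay hbc hby hcy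
  simp only [row, connEvent_sep, List.mem_singleton, forall_eq] at h
  simpa only [Set.compl_def] using h

/-- **The three-isolated-groups row on ≤ 5 vertices** (orbit 41; not implied): `0 ≤ E₃(D[abc|y], D[aby|c], D[acy|b])`. [this work] -/
theorem threeIsolated_le_five (hn : n ≤ 5) (w : Sym2 (Fin n) → unitInterval) (a b c y : Fin n) (hab : a ≠ b) (hac : a ≠ c)
    (hay : a ≠ y) (hbc : b ≠ c) (hby : b ≠ y) (hcy : c ≠ y) :
    0 ≤ sahiE3 (prodBernoulli w) {ω | ∀ x ∈ [a, b, c], ω ∉ openConn x y} {ω | ∀ x ∈ [a, b, y], ω ∉ openConn x c}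
      {ω | ∀ x ∈ [a, c, y], ω ∉ openConn x b} := by
  have h := frontier_sahiE3_le_five 41 hn w a b c y hab hac hay hbc hby hcy
  simpa only [row, connEvent_sep, List.mem_singleton, forall_eq] using h

end Summit.CriticalPhenomena.PercolationContinuityZ3.Theorems.FrontierDecRows
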